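import Summits.BirchSwinnertonDyer.Rank1Residual.X6.RankZeroCertificateEnclosure
import Summits.BirchSwinnertonDyer.Rank1Residual.X6.RankZeroCertificateInertPairNamed
import Summits.BirchSwinnertonDyer.BirchSwinnertonDyer.Theorems.PrintX6EisensteinHalfFiveLeRestPair
import Summits.BirchSwinnertonDyer.BirchSwinnertonDyer.Theorems.PrintX6EisensteinHalfFiveLeRestInertPairResidual
import HarnessLib

/-!
# Class X6 ∧ analytic rank `0` — `BSD(E,p)` for every certificate record at `p ≥ 5` BY NAME over the route's pack and the
# INERT-PAIR pack (road (I)): no open crux at `p ≥ 5`; the thin residual is EMPTY on the census; open crux only at `p = 3`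

Cell `bsd-print-x6` (D-0131 (2) print tier, key `x6`; HOME `run/shared/lean/pub/bsd-print-x6/`), typer seat ty3 (gen 7).
Successor of `RankZeroCertificateClaimResidual.lean` (p556955/p558087, after EDIT #4: Err road closed, Rest = open crux on 6
records, `p = 3` = open crux on 621; `openCrux_count_allRecords` 627/107/734) and `RankZeroCertificateEnclosure.lean` (p560348,
claim-free forms), for the planner's inert-pair refinement of the `p ≥ 5` residual (PLAN v4.6a/v4.7, RUNBOOK-edit5: E₅ = Err ∣
RestPair ∣ RestThin, RestPair closable BY NAME from prover p3's `AnticyclotomicRankZero.eisensteinHalfFiveLeRestPair_of_facts`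
(p566173, referee C-68), RestThin the declared residual) — composed with ty3's kernel certificates `Record.inertPairAt` /
`HasInertPair` (p561444 / p564740: 113 of the 113 records at `p ≥ 5` carry an inert pair). PARTITION (D-0054): leaf X6 ∧ r = 0
(K3 row A6) — types-the-object-of; closes NONE.

HONEST FRAMING: BSD is not proved here for any class or curve outright. Every `BSD(E,p)` below is per pair and CONDITIONAL, by
name, on (a) the route's input conjunction `PublishedInputsX6` (item stmt-BirchSwinnertonDyer-20302; nine refereed facts) and
(b) ty2's inert-pair pack `Supersingular.PublishedAcInputsX6Pair` (p564500; nine NAMED published facts of road (I): `hSh` CW24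
Thm 5.3 / JSW17 at good supersingular `p` on a Shimura curve, `hFH` Friedberg–Hoffstein inert/split supply, `hJL`, `hRT`
Ribet–Takahashi / Pasten–Shimura package, `h23` Castella 2018 Thm 2.3, `hK13` Kobayashi 2013 Rem 1.3, `hGZK`, `hnf`, `hMaz`) —
tier HELD by the cell referee on `hSh`'s flags `CW24-53+JSW17-512-composite`, `CW24-JSW17-LBDP-identification@HB15` (rider
`p ∣ ∏_{q∣N}(q²−1)`, R-5.2b; kernel columns p574374/p575128), `CW24-53-XrelstrReading` (REFEREE.md R-5.1 (b)) — and on (c)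
the record's two-engine CLAIM `Record.Claim` (analytic rank `0`) or, in the adapters, an explicit `r_an = 0` / the cell files'
enclosure line. `ClassX6`, `HasInertPair`, `Fact p.Prime`, `IsElliptic`, `IsGloballyMinimal` are KERNEL theorems from the
recheck (p534321, p561444). The `p = 3` records keep their open crux `EisensteinHalfAtThree` (stmt-BirchSwinnertonDyer-20285).
The unrefereed preprint BSTW arXiv:2409.01350 is NOT used anywhere in this file. This file does not depend on the route
edit itself: it is stated over ty2's pack and the inline thin body, exactly the types RUNBOOK-edit5 files as items.

WHAT THE DISPLAY SAYS (the census of record × the route's item structure after road (I)):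
* §0 pair level, the socket over the TWO packs: `PublishedInputsX6 → PublishedAcInputsX6Pair → 5 ≤ p → ClassX6 → r_an = 0 →
  HasInertPair → BSD(E,p)` (destructure the pack and the pair, then p2/p3's `X6.bsdp_of_publishedInputsX6_of_inertPairFacts`:
  upper half = the route's PROVED `UpperHalfX6`, lower half = road (I)); and the THIN socket: the two packs + the thin body
  (RestThin, inline) + `¬ HasErratumPrime` ⇒ `BSD(E,p)` (p3's em-glue gives `EisensteinHalfFiveLeRest`, then p2's Rest socket).
* §1 per record: `Record.bsdp_of_inertPairAt` — `5 ≤ p`, inert-pair certificate, claim ⇒ `BSD(E,p)` over the two packs, NO open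
  crux, NO Err ∣ Rest case split (a second road for the 107 Err records, the first crux-free road for the 6 Rest records);
  `Record.restThin_of_inertPairAt` — the RestThin body HOLDS at the record (vacuously: the certificate refutes `¬ HasInertPair`);
  `Record.bsdp_of_residuals_afterPair` — any certified record over the route's items after the refinement
  (`PublishedInputsX6`, `PublishedAcInputsX6Err`, `PublishedAcInputsX6Pair`, the thin body, `EisensteinHalfAtThree`).
* §2 census over `allRecords`: `bsdp_of_mem_five_le` (**all 113 records at `p ≥ 5`: `BSD(E,p)` over the two packs, no open
  crux**), `restThin_of_mem_five_le` (**the declared residual RestThin is discharged at every census record at `p ≥ 5`**),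
  `item_dichotomy_of_mem` (`p = 3`, or `p ≥ 5` with an inert pair), `openCrux_count_afterPair_allRecords` (113 closed modulo the
  packs / 0 thin / 621 at `p = 3` / 734), `bsdp_of_mem_of_pairPack_of_atThree` (**all 734 over `PublishedInputsX6 ∧
  PublishedAcInputsX6Pair ∧ EisensteinHalfAtThree`** — the Err pack is not needed on the census, every Err record also carries
  an inert pair); claim-free twins from the record's own level-one enclosure line (`Record.bsdp_of_inertPairAt_of_LOneBall`,
  `bsdp_of_mem_five_le_of_LOneBall`; targets `(I, den, c_∞)` = p560348 `encTargets_five_le`, two engines kit j287799).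
* §3 `hWeq` adapters for the cell files: `bsdp_of_exists_inertPairAt` (`hPub`, `hAcP`, `h0`), `bsdp_of_exists_inertPairAt_of_LOneBall`
  (the cell files' verbatim `hball0` through the tree's `Supersingular.analyticRank_eq_zero_of_LOneBall`), `restThin_of_exists_inertPairAt`;
  and BY NAME the six former-Rest cells `138594b1, 246697a1, 321518d1, 331554a1 @ 5`, `12927e1, 399190l1 @ 7`, the four
  `q = 2`-only Err cells `65774b1, 145146q1, 220022c1, 476882e1 @ 5` (road (E)'s `Cas18-Thm32-dK-odd` rider does not arise on
  road (I)), and the T3 witness cell `22678e1 @ 5`: `bsdp_cell_<label>_at<p>_of_publishedInputsX6_of_publishedAcInputsX6Pair`.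

Two engines behind the certificates: HOME/ty3/inertpair/X6R0-INERTPAIR-UNITCONJ-v2.tsv (pure Python from Cremona/PARI bad-prime
data) and the kernel (`decide +kernel`). beyond-print theorem: NO (bookkeeping over landed theorems; the beyond-print content is
road (I)'s, HELD). References: Kobayashi 2003 Thm. 1.2 / 4.1 [Kobayashi2003]; B. D. Kim 2013 Cor. 3.15 [BDKim2013]; Castella–Wan
2024 Thm. 5.3 [CastellaWan2023]; Jetchev–Skinner–Wan 2017 §5.1.2, §7.4 [JetchevSkinnerWan2017]; Miller 2011 Def. 1.1 [Miller2011LMS];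
Silverman *AEC* VII.5 Prop. 5.1 [SilvermanAEC2009]; [BirchSwinnertonDyer1965]; Mazur–Tate–Teitelbaum 1986 §I.8
[MazurTateTeitelbaum1986Invent]; Cremona's tables [Cremona2006]; HOME/PLAN.md v4.6a–v4.7, HOME/plan/RUNBOOK-edit5.md.
-/

set_option autoImplicit false

open scoped MatrixGroups ModularForm
open CongruenceSubgroup WeierstrassCurve Literature.NumberTheory.EllipticCurves Literature.NumberTheory.EllipticCurves.ModularForms
  Literature.NumberTheory.EllipticCurves.Rank1Residual
-- only these names from the route namespace and from ty2's (edit #5 adds a route-level `PublishedAcInputsX6Pair` wrapper)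
open Summit.BirchSwinnertonDyer.BirchSwinnertonDyer.Theses.PrintX6 (PublishedInputsX6 PublishedAcInputsX6Err EisensteinHalfAtThree)
open Summit.BirchSwinnertonDyer.Rank1Residual.Supersingular
  (HasErratumPrime HasInertPair PublishedAcInputsX6Pair analyticRank_eq_zero_of_LOneBall)

namespace Summit.BirchSwinnertonDyer.Rank1Residual.X6.PrintCert

/-! ### §0 Pair level: the sockets over the two packs -/

/-- **`BSD(E,p)` on the inert-pair sub-locus of the leaf over the TWO packs, by name**: `PublishedInputsX6` (upper half =
the route's PROVED `UpperHalfX6`, GZK, modularity) and ty2's `PublishedAcInputsX6Pair` (the nine facts of road (I); lower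
half on the non-unit value by `AnticyclotomicRankZero.eisensteinHalfFiveLe_inertPair_of_facts`) — destructure both and apply
p2/p3's `X6.bsdp_of_publishedInputsX6_of_inertPairFacts`. No `HasErratumPrime` case split. CONDITIONAL (pack tier HELD).
[cite: Kobayashi2003, Thm. 1.2 (p. 2) and Thm. 4.1 (p. 8)] [cite: BDKim2013, Cor. 3.15 (p. 199)]
[cite: CastellaWan2023, Thm. 5.3] [cite: JetchevSkinnerWan2017, §5.1.2, §7.4] [cite: Miller2011LMS, §1 and Def. 1.1] -/
theorem bsdp_of_publishedInputsX6_of_publishedAcInputsX6Pair_of_hasInertPair (hPub : PublishedInputsX6)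
    (hAcP : PublishedAcInputsX6Pair) (W : WeierstrassCurve ℚ) [W.IsElliptic] [W.IsGloballyMinimal] (p : ℕ) [Fact p.Prime]
    (h5 : 5 ≤ p) (hX : ClassX6 W p) (h0 : W.analyticRank = 0) (hP : HasInertPair W p) : BSDp W p := by
  obtain ⟨hSh, hFH, hJL, hRT, h23, hK13, hGZK, hnf, hMaz⟩ := hAcP
  obtain ⟨ℓ₁, ℓ₂, i₁, i₂, hne, h₁, h₂, hr₁, hr₂⟩ := hP
  exact Summit.BirchSwinnertonDyer.BirchSwinnertonDyer.Theorems.X6.bsdp_of_publishedInputsX6_of_inertPairFacts hSh hFH hJL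
    hRT h23 hK13 hGZK hnf hMaz W p hPub h5 hX h0 ℓ₁ ℓ₂ hne h₁ h₂ hr₁ hr₂

/-- **`BSD(E,p)` off the inert-pair and erratum sub-loci over the two packs and the THIN BODY** (the planner's declared residual
`EisensteinHalfFiveLeRestThin`, spelled inline exactly as RUNBOOK-edit5 files it): p3's em-glue
`eisensteinHalfFiveLeRest_of_publishedAcInputsX6Pair_of_thinBody` gives the crux `EisensteinHalfFiveLeRest`, then p2's Rest
socket `X6.bsdp_of_publishedInputsX6_of_rest_of_not_hasErratumPrime`. CONDITIONAL on the packs and the thin body.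
[cite: Kobayashi2003, Thm. 1.2 (p. 2) and Thm. 4.1 (p. 8)] [cite: BDKim2013, Cor. 3.15 (p. 199)] [cite: Miller2011LMS, §1 and Def. 1.1] -/
theorem bsdp_of_publishedInputsX6_of_publishedAcInputsX6Pair_of_thinBody (hPub : PublishedInputsX6)
    (hAcP : PublishedAcInputsX6Pair)
    (hThin : ∀ (W : WeierstrassCurve ℚ) [W.IsElliptic] [W.IsGloballyMinimal] (p : ℕ) [Fact p.Prime],
      ¬ W.HasCM → 5 ≤ p → ClassX6 W p → W.analyticRank = 0 → ¬ HasErratumPrime W p → ¬ HasInertPair W p →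
      ∀ q : ℚ, shaAn W = (q : ℂ) → padicValRat p q ≠ 0 → padicValRat p q ≤ (padicValNat p W.shaOrder : ℤ))
    (W : WeierstrassCurve ℚ) [W.IsElliptic] [W.IsGloballyMinimal] (p : ℕ) [Fact p.Prime]
    (h5 : 5 ≤ p) (hX : ClassX6 W p) (h0 : W.analyticRank = 0) (hE : ¬ HasErratumPrime W p) : BSDp W p :=
  Summit.BirchSwinnertonDyer.BirchSwinnertonDyer.Theorems.X6.bsdp_of_publishedInputsX6_of_rest_of_not_hasErratumPrime W p hPub
    (Summit.BirchSwinnertonDyer.BirchSwinnertonDyer.Theorems.AnticyclotomicRankZero.eisensteinHalfFiveLeRest_of_publishedAcInputsX6Pair_of_thinBody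
      hAcP hThin) h5 hX h0 hE

/-! ### §1 Per record: `BSD(E,p)` by the inert-pair certificate; the thin body at the record -/

namespace Record

variable (r : Record) [Fact r.p.Prime] [r.curve.IsElliptic] [r.curve.IsGloballyMinimal]

/-- **INERT-PAIR road (no open crux, no Err ∣ Rest split).** For a certified record at `p ≥ 5` with the inert-pair certificate
(`inertPairAt`: two distinct listed multiplicative primes with `p ∤ ord Δ`, so `HasInertPair`, kernel theorem
`hasInertPair_of_check`) whose claim holds: `BSD(E,p)` over `PublishedInputsX6 ∧ PublishedAcInputsX6Pair` — §0's socket with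
`ClassX6` from the recheck and `r_an = 0` the claim. What each of the 113 census cells at `p ≥ 5` inherits (p561444: 113/113 carry
the certificate). CONDITIONAL on the two packs (tier HELD). [cite: Kobayashi2003, Thm. 1.2 (p. 2) and Thm. 4.1 (p. 8)]
[cite: BDKim2013, Cor. 3.15 (p. 199)] [cite: SilvermanAEC2009, VII.5 Prop. 5.1(b)] [cite: Miller2011LMS, §1 and Def. 1.1] -/
theorem bsdp_of_inertPairAt (hPub : PublishedInputsX6) (hAcP : PublishedAcInputsX6Pair) (hc : r.check = true) (h : r.Claim)
    (h5 : 5 ≤ r.p) (hP : r.inertPairAt = true) : BSDp r.curve r.p :=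
  bsdp_of_publishedInputsX6_of_publishedAcInputsX6Pair_of_hasInertPair hPub hAcP r.curve r.p h5 (r.classX6_of_check hc) h.1
    (r.hasInertPair_of_check hc hP)

/-- **The THIN BODY holds at a record with the inert-pair certificate** — vacuously: `¬ HasInertPair` is refuted by the kernel
theorem `hasInertPair_of_check` (the declared residual RestThin at the record's pair). [cite: SilvermanAEC2009, VII.5 Prop. 5.1(b)] -/
theorem restThin_of_inertPairAt (hc : r.check = true) (hP : r.inertPairAt = true) :
    ¬ r.curve.HasCM → 5 ≤ r.p → ClassX6 r.curve r.p → r.curve.analyticRank = 0 → ¬ HasErratumPrime r.curve r.p →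
      ¬ HasInertPair r.curve r.p → ∀ q : ℚ, Literature.NumberTheory.EllipticCurves.shaAn r.curve = (q : ℂ) → padicValRat r.p q ≠ 0 →
        padicValRat r.p q ≤ (padicValNat r.p r.curve.shaOrder : ℤ) :=
  fun _ _ _ _ _ hnP => absurd (r.hasInertPair_of_check hc hP) hnP

/-- **Any certified record over the route's items after the inert-pair refinement** (no certificate needed: a certified `p` is
`3` or `≥ 5`; at `p ≥ 5` the case splits on `HasInertPair` and `HasErratumPrime` are classical): `PublishedInputsX6`,
`PublishedAcInputsX6Err`, `PublishedAcInputsX6Pair`, the thin body and `EisensteinHalfAtThree`, with the record's claim, give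
`BSD(E,p)`. CONDITIONAL on all of them. [cite: Kobayashi2003, Thm. 1.2 (p. 2) and Thm. 4.1 (p. 8)]
[cite: BDKim2013, Cor. 3.15 (p. 199)] [cite: Miller2011LMS, §1 and Def. 1.1] -/
theorem bsdp_of_residuals_afterPair (hPub : PublishedInputsX6) (hAc : PublishedAcInputsX6Err) (hAcP : PublishedAcInputsX6Pair)
    (hThin : ∀ (W : WeierstrassCurve ℚ) [W.IsElliptic] [W.IsGloballyMinimal] (p : ℕ) [Fact p.Prime],
      ¬ W.HasCM → 5 ≤ p → ClassX6 W p → W.analyticRank = 0 → ¬ HasErratumPrime W p → ¬ HasInertPair W p →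
      ∀ q : ℚ, Literature.NumberTheory.EllipticCurves.shaAn W = (q : ℂ) → padicValRat p q ≠ 0 → padicValRat p q ≤ (padicValNat p W.shaOrder : ℤ))
    (hT : EisensteinHalfAtThree) (hc : r.check = true) (h : r.Claim) : BSDp r.curve r.p :=
  r.bsdp_of_residuals hPub hAc
    (Summit.BirchSwinnertonDyer.BirchSwinnertonDyer.Theorems.AnticyclotomicRankZero.eisensteinHalfFiveLeRest_of_publishedAcInputsX6Pair_of_thinBody
      hAcP hThin) hT hc h

/-- **INERT-PAIR road, claim-free**: a certified record at `p ≥ 5` with the inert-pair certificate, over the two packs and its own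
level-one enclosure line (`|encDen·(cInf·(Re L(E,1)/Ω⁺_f)) − mid| ≤ rad ≤ 10⁻²⁰`, `|mid − encI| ≤ 10⁻²⁰`; targets p560348, two
engines kit j287799): `BSD(E,p)` — `r_an = 0` by `Record.analyticRank_eq_zero_of_LOneBall`. NO open crux; no claim.
[cite: Kobayashi2003, Thm. 1.2 (p. 2) and Thm. 4.1 (p. 8)] [cite: BDKim2013, Cor. 3.15 (p. 199)] [cite: BirchSwinnertonDyer1965]
[cite: MazurTateTeitelbaum1986Invent, §I.8] [cite: Miller2011LMS, §1 and Def. 1.1] -/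
theorem bsdp_of_inertPairAt_of_LOneBall (hPub : PublishedInputsX6) (hAcP : PublishedAcInputsX6Pair) (hc : r.check = true)
    (h5 : 5 ≤ r.p) (hP : r.inertPairAt = true) {N : ℕ} [NeZero N] (f : CuspForm (Gamma0 N) 2)
    (hball0 : ∃ mid rad : ℝ, rad ≤ 1 / 10 ^ (20 : ℕ) ∧ |mid - (((r.encI : ℕ) : ℤ) : ℝ)| ≤ 1 / 10 ^ (20 : ℕ) ∧
      |((r.encDen : ℕ) : ℝ) * (((r.cInf : ℕ) : ℝ) * ((r.curve.entireLFunction 1).re / plusPeriod f)) - mid| ≤ rad) :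
    BSDp r.curve r.p :=
  bsdp_of_publishedInputsX6_of_publishedAcInputsX6Pair_of_hasInertPair hPub hAcP r.curve r.p h5 (r.classX6_of_check hc)
    (r.analyticRank_eq_zero_of_LOneBall hc f hball0) (r.hasInertPair_of_check hc hP)

end Record

/-! ### §2 The census over `allRecords`: no open crux at `p ≥ 5`; the thin residual is empty; open crux only at `p = 3` -/

section Lists

variable {rs : List Record}

/-- **INERT-PAIR road, list form, instance-free**: for every record of a `certified` list whose claims hold, at `p ≥ 5` with the
inert-pair certificate, `BSD(E,p)` over `PublishedInputsX6 ∧ PublishedAcInputsX6Pair` — NO open crux.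
[cite: Kobayashi2003, Thm. 1.2 (p. 2) and Thm. 4.1 (p. 8)] [cite: BDKim2013, Cor. 3.15 (p. 199)] [cite: Miller2011LMS, §1 and Def. 1.1] -/
theorem bsdp_of_certified_of_claims_of_inertPairAt (hPub : PublishedInputsX6) (hAcP : PublishedAcInputsX6Pair)
    (hC : certified rs = true) (hcl : Claims rs) (r : Record) (hr : r ∈ rs) (h5 : 5 ≤ r.p) (hP : r.inertPairAt = true) :
    haveI := r.fact_prime_of_check (check_of_mem_of_certified hC hr)
    haveI := (r.elliptic_and_minimal_of_check (check_of_mem_of_certified hC hr)).1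
    haveI := (r.elliptic_and_minimal_of_check (check_of_mem_of_certified hC hr)).2
    BSDp r.curve r.p := by
  have hc := check_of_mem_of_certified hC hr
  haveI := r.fact_prime_of_check hc
  haveI := (r.elliptic_and_minimal_of_check hc).1
  haveI := (r.elliptic_and_minimal_of_check hc).2
  exact r.bsdp_of_inertPairAt hPub hAcP hc (hcl r hr) h5 hP

end Lists

/-- **ALL 113 census cells at `p ≥ 5`: `BSD(E,p)` by name with NO open crux** — over `PublishedInputsX6 ∧ PublishedAcInputsX6Pair`
and the records' claims, for EVERY record of `allRecords` with `5 ≤ p` (the inert-pair certificate holds on all of them,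
`inertPairAt_of_mem_five_le`; 107 Err + 6 Rest). Tier of the pack: HELD (the referee rules); cells are booked by the director,
not here. [cite: Kobayashi2003, Thm. 1.2 (p. 2) and Thm. 4.1 (p. 8)] [cite: BDKim2013, Cor. 3.15 (p. 199)]
[cite: Miller2011LMS, §1 and Def. 1.1] -/
theorem bsdp_of_mem_five_le (hPub : PublishedInputsX6) (hAcP : PublishedAcInputsX6Pair) (hcl : Claims allRecords)
    (r : Record) (hr : r ∈ allRecords) (h5 : 5 ≤ r.p) :
    haveI := r.fact_prime_of_check (check_of_mem_of_certified certified_allRecords hr)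
    haveI := (r.elliptic_and_minimal_of_check (check_of_mem_of_certified certified_allRecords hr)).1
    haveI := (r.elliptic_and_minimal_of_check (check_of_mem_of_certified certified_allRecords hr)).2
    BSDp r.curve r.p := by
  have hx := List.all_eq_true.mp inertPairAt_of_mem_five_le r hr
  simp only [Bool.or_eq_true, Bool.not_eq_true', decide_eq_false_iff_not] at hx
  rcases hx with hlt | hP
  · exact absurd h5 hlt
  · exact bsdp_of_certified_of_claims_of_inertPairAt hPub hAcP certified_allRecords hcl r hr h5 hP

/-- **The declared residual RestThin is DISCHARGED at every census record at `p ≥ 5`** (113/113): the thin body holds at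
`(r.curve, r.p)` because the record carries an inert pair (`hasInertPair_of_mem`). The residual is supported on ZERO census
records. [cite: SilvermanAEC2009, VII.5 Prop. 5.1(b)] -/
theorem restThin_of_mem_five_le (r : Record) (hr : r ∈ allRecords) (h5 : 5 ≤ r.p) :
    haveI := r.fact_prime_of_check (check_of_mem_of_certified certified_allRecords hr)
    haveI := (r.elliptic_and_minimal_of_check (check_of_mem_of_certified certified_allRecords hr)).1
    haveI := (r.elliptic_and_minimal_of_check (check_of_mem_of_certified certified_allRecords hr)).2
    (¬ r.curve.HasCM → 5 ≤ r.p → ClassX6 r.curve r.p → r.curve.analyticRank = 0 → ¬ HasErratumPrime r.curve r.p →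
      ¬ HasInertPair r.curve r.p → ∀ q : ℚ, shaAn r.curve = (q : ℂ) → padicValRat r.p q ≠ 0 →
        padicValRat r.p q ≤ (padicValNat r.p r.curve.shaOrder : ℤ)) :=
  fun _ _ _ _ _ hnP => absurd (hasInertPair_of_mem r hr h5) hnP

/-- **Which item each census record waits on after the refinement**: `p = 3` (open crux `EisensteinHalfAtThree`) or `p ≥ 5` WITH
the inert-pair certificate (no open crux; pack tier HELD) — never thin. [folklore] -/
theorem item_dichotomy_of_mem (r : Record) (hr : r ∈ allRecords) : r.p = 3 ∨ (5 ≤ r.p ∧ r.inertPairAt = true) := by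
  rcases (r.reduction_of_check (check_of_mem_of_certified certified_allRecords hr)).1 with h3 | h5
  · exact Or.inl h3
  · have hx := List.all_eq_true.mp inertPairAt_of_mem_five_le r hr
    simp only [Bool.or_eq_true, Bool.not_eq_true', decide_eq_false_iff_not] at hx
    rcases hx with hlt | hP
    · exact absurd h5 hlt
    · exact Or.inr ⟨h5, hP⟩

/-- **The open-crux count after the refinement**: 113 records at `p ≥ 5` closed by name modulo the packs, 0 thin (`p ≥ 5` without
the certificate), exactly the 621 at `p = 3` on an OPEN crux; 734 in all. Before (p556955 `openCrux_count_allRecords`): 627 / 107. [folklore] -/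
theorem openCrux_count_afterPair_allRecords :
    (allRecords.filter fun r => 5 ≤ r.p ∧ r.inertPairAt = true).length = 113 ∧
    (allRecords.filter fun r => 5 ≤ r.p ∧ r.inertPairAt = false).length = 0 ∧
    (allRecords.filter fun r => r.p = 3).length = 621 ∧ allRecords.length = 734 :=
  ⟨inertPair_counts_allRecords.2.1, errRest_inertPair_counts_five_le.2.2, count_allRecords.2.1, count_allRecords.1⟩

/-- **All 734 census cells: `BSD(E,p)` over exactly `PublishedInputsX6`, the inert-pair pack and the `p = 3` crux** (and the
records' claims) — the Err pack `PublishedAcInputsX6Err` and the thin body are NOT needed on the census: every record at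
`p ≥ 5` carries an inert pair. [cite: Kobayashi2003, Thm. 1.2 (p. 2) and Thm. 4.1 (p. 8)] [cite: BDKim2013, Cor. 3.15 (p. 199)]
[cite: Miller2011LMS, §1 and Def. 1.1] -/
theorem bsdp_of_mem_of_pairPack_of_atThree (hPub : PublishedInputsX6) (hAcP : PublishedAcInputsX6Pair)
    (hT : EisensteinHalfAtThree) (hcl : Claims allRecords) (r : Record) (hr : r ∈ allRecords) :
    haveI := r.fact_prime_of_check (check_of_mem_of_certified certified_allRecords hr)
    haveI := (r.elliptic_and_minimal_of_check (check_of_mem_of_certified certified_allRecords hr)).1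
    haveI := (r.elliptic_and_minimal_of_check (check_of_mem_of_certified certified_allRecords hr)).2
    BSDp r.curve r.p := by
  have hc := check_of_mem_of_certified certified_allRecords hr
  haveI := r.fact_prime_of_check hc
  haveI := (r.elliptic_and_minimal_of_check hc).1
  haveI := (r.elliptic_and_minimal_of_check hc).2
  rcases item_dichotomy_of_mem r hr with h3 | ⟨h5, hP⟩
  · exact r.bsdp_of_p_eq_three hPub hT hc (hcl r hr) h3
  · exact r.bsdp_of_inertPairAt hPub hAcP hc (hcl r hr) h5 hP

/-- **All 113 census cells at `p ≥ 5`, claim-free**: for every listed record with `5 ≤ p`, the two packs and the record's own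
enclosure line (kit j287799 row; targets `encTargets_five_le`) give `BSD(E,p)` — NO open crux, NO claim.
[cite: Kobayashi2003, Thm. 1.2 (p. 2) and Thm. 4.1 (p. 8)] [cite: BDKim2013, Cor. 3.15 (p. 199)] [cite: BirchSwinnertonDyer1965]
[cite: Miller2011LMS, §1 and Def. 1.1] -/
theorem bsdp_of_mem_five_le_of_LOneBall (hPub : PublishedInputsX6) (hAcP : PublishedAcInputsX6Pair) (r : Record)
    (hr : r ∈ allRecords) (h5 : 5 ≤ r.p) {N : ℕ} [NeZero N] (f : CuspForm (Gamma0 N) 2)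
    (hball0 : ∃ mid rad : ℝ, rad ≤ 1 / 10 ^ (20 : ℕ) ∧ |mid - (((r.encI : ℕ) : ℤ) : ℝ)| ≤ 1 / 10 ^ (20 : ℕ) ∧
      |((r.encDen : ℕ) : ℝ) * (((r.cInf : ℕ) : ℝ) * ((r.curve.entireLFunction 1).re / plusPeriod f)) - mid| ≤ rad) :
    haveI := r.fact_prime_of_check (check_of_mem_of_certified certified_allRecords hr)
    haveI := (r.elliptic_and_minimal_of_check (check_of_mem_of_certified certified_allRecords hr)).1
    haveI := (r.elliptic_and_minimal_of_check (check_of_mem_of_certified certified_allRecords hr)).2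
    BSDp r.curve r.p := by
  have hc := check_of_mem_of_certified certified_allRecords hr
  haveI := r.fact_prime_of_check hc
  haveI := (r.elliptic_and_minimal_of_check hc).1
  haveI := (r.elliptic_and_minimal_of_check hc).2
  rcases item_dichotomy_of_mem r hr with h3 | ⟨-, hP⟩
  · exact absurd h5 (by omega)
  · exact r.bsdp_of_inertPairAt_of_LOneBall hPub hAcP hc h5 hP f hball0

/-! ### §3 `hWeq` adapters for the cell files, and the cells by name -/

section Adapters

variable {rs : List Record} {W : WeierstrassCurve ℚ} [W.IsElliptic] [W.IsGloballyMinimal]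
  {a1 a2 a3 a4 a6 : ℤ} {p : ℕ} [Fact p.Prime]

/-- **`BSD(E,p)` at an inert-pair cell in the `hWeq` shape** (any of the 113 at `p ≥ 5`; membership `by decide +kernel` in the
part `recordsNN` holding the label): over `PublishedInputsX6 ∧ PublishedAcInputsX6Pair` and an explicit `r_an = 0` (the
consumer's: an enclosure line or the claim) — `ClassX6` and `HasInertPair` are the record's kernel theorems. NO open crux.
[cite: Kobayashi2003, Thm. 1.2 (p. 2) and Thm. 4.1 (p. 8)] [cite: BDKim2013, Cor. 3.15 (p. 199)]
[cite: SilvermanAEC2009, VII.5 Prop. 5.1(b)] [cite: Miller2011LMS, §1 and Def. 1.1] -/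
theorem bsdp_of_exists_inertPairAt (hrs : certified rs = true)
    (h : ∃ r ∈ rs, r.ainvs = [a1, a2, a3, a4, a6] ∧ r.p = p ∧ r.inertPairAt = true)
    (hWeq : W = ⟨a1, a2, a3, a4, a6⟩) (hPub : PublishedInputsX6) (hAcP : PublishedAcInputsX6Pair) (h5 : 5 ≤ p)
    (h0 : W.analyticRank = 0) : BSDp W p := by
  obtain ⟨r, hr, hA, hp, hP⟩ := h
  have hc := check_of_mem_of_certified hrs hr
  have hW : W = r.curve := by rw [hWeq]; exact r.curve_eq hA
  subst hW
  subst hp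
  exact bsdp_of_publishedInputsX6_of_publishedAcInputsX6Pair_of_hasInertPair hPub hAcP r.curve r.p h5
    (r.classX6_of_check hc) h0 (r.hasInertPair_of_check hc hP)

/-- **`BSD(E,p)` at an inert-pair cell from the packs and the cell files' LEVEL-ONE ENCLOSURE LINE, verbatim** — binders
`hPub`, `hAcP`, `hWeq`, the newform-level `f` of `Ω⁺_f`, `hball0 : ∃ mid rad, rad ≤ R ∧ |mid − I| ≤ Mr ∧ |den·(c·(Re L(E,1)/Ω⁺_f)) − mid| ≤ rad`
(`I ≠ 0`, `R + Mr < 1`): `r_an = 0` by the tree's UNCONDITIONAL `Supersingular.analyticRank_eq_zero_of_LOneBall`. NO open crux.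
[cite: Kobayashi2003, Thm. 1.2 (p. 2) and Thm. 4.1 (p. 8)] [cite: BDKim2013, Cor. 3.15 (p. 199)] [cite: BirchSwinnertonDyer1965]
[cite: MazurTateTeitelbaum1986Invent, §I.8] [cite: Miller2011LMS, §1 and Def. 1.1] -/
theorem bsdp_of_exists_inertPairAt_of_LOneBall (hrs : certified rs = true)
    (h : ∃ r ∈ rs, r.ainvs = [a1, a2, a3, a4, a6] ∧ r.p = p ∧ r.inertPairAt = true)
    (hWeq : W = ⟨a1, a2, a3, a4, a6⟩) (hPub : PublishedInputsX6) (hAcP : PublishedAcInputsX6Pair) (h5 : 5 ≤ p)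
    {N : ℕ} [NeZero N] (f : CuspForm (Gamma0 N) 2) (R Mr den c : ℝ) (I : ℤ) (hI : I ≠ 0) (hsmall : R + Mr < 1)
    (hball0 : ∃ mid rad : ℝ, rad ≤ R ∧ |mid - ((I : ℤ) : ℝ)| ≤ Mr ∧
      |den * (c * ((W.entireLFunction 1).re / plusPeriod f)) - mid| ≤ rad) :
    BSDp W p :=
  bsdp_of_exists_inertPairAt hrs h hWeq hPub hAcP h5 (analyticRank_eq_zero_of_LOneBall f R Mr den c I hI hsmall hball0)

/-- **The thin body at an inert-pair cell in the `hWeq` shape** — vacuous (`HasInertPair` is the record's kernel theorem).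
[cite: SilvermanAEC2009, VII.5 Prop. 5.1(b)] -/
theorem restThin_of_exists_inertPairAt (hrs : certified rs = true)
    (h : ∃ r ∈ rs, r.ainvs = [a1, a2, a3, a4, a6] ∧ r.p = p ∧ r.inertPairAt = true)
    (hWeq : W = ⟨a1, a2, a3, a4, a6⟩) :
    ¬ W.HasCM → 5 ≤ p → ClassX6 W p → W.analyticRank = 0 → ¬ HasErratumPrime W p → ¬ HasInertPair W p →
      ∀ q : ℚ, shaAn W = (q : ℂ) → padicValRat p q ≠ 0 → padicValRat p q ≤ (padicValNat p W.shaOrder : ℤ) :=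
  fun _ _ _ _ _ hnP => absurd (hasInertPair_of_exists hrs h hWeq) hnP

end Adapters

section Cells

variable {W : WeierstrassCurve ℚ} [W.IsElliptic] [W.IsGloballyMinimal]

/-- **Former Rest cell `138594b1 @ 5`** (all bad primes split; inert pair `(2, 3)`): `BSD(E,5)` over the two packs and `r_an = 0`
— NO open crux (before the refinement: the open crux `EisensteinHalfFiveLeRest`). Per pair. [cite: Cremona2006, Table 1 (138594b1)] -/
theorem bsdp_cell_138594b1_at5_of_publishedInputsX6_of_publishedAcInputsX6Pair [Fact (Nat.Prime 5)]
    (hWeq : W = ⟨1, 0, 0, -1443, -21219⟩) (hPub : PublishedInputsX6) (hAcP : PublishedAcInputsX6Pair)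
    (h0 : W.analyticRank = 0) : BSDp W 5 :=
  bsdp_of_exists_inertPairAt certified_records14 (by decide +kernel) hWeq hPub hAcP (by norm_num) h0

/-- **Former Rest cell `246697a1 @ 5`** (no pair with the unit conjunct, p574374): `BSD(E,5)` over the two packs and `r_an = 0`.
[cite: Cremona2006, Table 1 (Cremona label 246697a1)] [cite: Miller2011LMS, §1 and Def. 1.1] -/
theorem bsdp_cell_246697a1_at5_of_publishedInputsX6_of_publishedAcInputsX6Pair [Fact (Nat.Prime 5)]
    (hWeq : W = ⟨0, 0, 1, -292934695, -1929764585205⟩) (hPub : PublishedInputsX6) (hAcP : PublishedAcInputsX6Pair)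
    (h0 : W.analyticRank = 0) : BSDp W 5 :=
  bsdp_of_exists_inertPairAt certified_records14 (by decide +kernel) hWeq hPub hAcP (by norm_num) h0

/-- **Former Rest cell `321518d1 @ 5`**: `BSD(E,5)` over the two packs and `r_an = 0`. [cite: Cremona2006, Table 1 (321518d1)] -/
theorem bsdp_cell_321518d1_at5_of_publishedInputsX6_of_publishedAcInputsX6Pair [Fact (Nat.Prime 5)]
    (hWeq : W = ⟨1, 0, 0, -80858, -9082420⟩) (hPub : PublishedInputsX6) (hAcP : PublishedAcInputsX6Pair)
    (h0 : W.analyticRank = 0) : BSDp W 5 :=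
  bsdp_of_exists_inertPairAt certified_records15 (by decide +kernel) hWeq hPub hAcP (by norm_num) h0

/-- **Former Rest cell `331554a1 @ 5`** (pair `(2, 3)`): `BSD(E,5)` over the two packs and `r_an = 0`. [cite: Cremona2006, Table 1 (331554a1)] -/
theorem bsdp_cell_331554a1_at5_of_publishedInputsX6_of_publishedAcInputsX6Pair [Fact (Nat.Prime 5)]
    (hWeq : W = ⟨1, 0, 0, -3453, -78387⟩) (hPub : PublishedInputsX6) (hAcP : PublishedAcInputsX6Pair)
    (h0 : W.analyticRank = 0) : BSDp W 5 :=
  bsdp_of_exists_inertPairAt certified_records15 (by decide +kernel) hWeq hPub hAcP (by norm_num) h0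

/-- **Former Rest cell `12927e1 @ 7`** (pair `(3, 31)`; p4's descent road p551746 is the other road): `BSD(E,7)` over the two packs
and `r_an = 0`. [cite: Cremona2006, Table 1 (Cremona label 12927e1)] -/
theorem bsdp_cell_12927e1_at7_of_publishedInputsX6_of_publishedAcInputsX6Pair [Fact (Nat.Prime 7)]
    (hWeq : W = ⟨1, 0, 0, -42189461, -105479619702⟩) (hPub : PublishedInputsX6) (hAcP : PublishedAcInputsX6Pair)
    (h0 : W.analyticRank = 0) : BSDp W 7 :=
  bsdp_of_exists_inertPairAt certified_records16 (by decide +kernel) hWeq hPub hAcP (by norm_num) h0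

/-- **Former Rest cell `399190l1 @ 7`** (the one Rest cell passing the all-`q` guard, p575128): `BSD(E,7)` over the two packs
and `r_an = 0`. [cite: Cremona2006, Table 1 (Cremona label 399190l1)] -/
theorem bsdp_cell_399190l1_at7_of_publishedInputsX6_of_publishedAcInputsX6Pair [Fact (Nat.Prime 7)]
    (hWeq : W = ⟨1, -1, 1, -8615202972, -2594053676135591⟩) (hPub : PublishedInputsX6) (hAcP : PublishedAcInputsX6Pair)
    (h0 : W.analyticRank = 0) : BSDp W 7 :=
  bsdp_of_exists_inertPairAt certified_records16 (by decide +kernel) hWeq hPub hAcP (by norm_num) h0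

/-- **`q = 2`-only Err cell `65774b1 @ 5`** (road (E) only through `q = 2`, rider `Cas18-Thm32-dK-odd@BDP13`; road (I) through
the inert pair `(2, 32887)`): `BSD(E,5)` over the two packs and `r_an = 0`. [cite: Cremona2006, Table 1 (Cremona label 65774b1)] -/
theorem bsdp_cell_65774b1_at5_of_publishedInputsX6_of_publishedAcInputsX6Pair [Fact (Nat.Prime 5)]
    (hWeq : W = ⟨1, 1, 0, -2045, -80707⟩) (hPub : PublishedInputsX6) (hAcP : PublishedAcInputsX6Pair)
    (h0 : W.analyticRank = 0) : BSDp W 5 :=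
  bsdp_of_exists_inertPairAt certified_records14 (by decide +kernel) hWeq hPub hAcP (by norm_num) h0

/-- **`q = 2`-only Err cell `145146q1 @ 5`** (cell C4): `BSD(E,5)` over the two packs and `r_an = 0`.
[cite: Cremona2006, Table 1 (Cremona label 145146q1)] -/
theorem bsdp_cell_145146q1_at5_of_publishedInputsX6_of_publishedAcInputsX6Pair [Fact (Nat.Prime 5)]
    (hWeq : W = ⟨1, 0, 1, -3229945761, -70654953055340⟩) (hPub : PublishedInputsX6) (hAcP : PublishedAcInputsX6Pair)
    (h0 : W.analyticRank = 0) : BSDp W 5 :=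
  bsdp_of_exists_inertPairAt certified_records14 (by decide +kernel) hWeq hPub hAcP (by norm_num) h0

/-- **`q = 2`-only Err cell `220022c1 @ 5`**: `BSD(E,5)` over the two packs and `r_an = 0`. [cite: Cremona2006, Table 1 (220022c1)] -/
theorem bsdp_cell_220022c1_at5_of_publishedInputsX6_of_publishedAcInputsX6Pair [Fact (Nat.Prime 5)]
    (hWeq : W = ⟨1, -1, 0, -766181797, -8161933796331⟩) (hPub : PublishedInputsX6) (hAcP : PublishedAcInputsX6Pair)
    (h0 : W.analyticRank = 0) : BSDp W 5 :=
  bsdp_of_exists_inertPairAt certified_records14 (by decide +kernel) hWeq hPub hAcP (by norm_num) h0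

/-- **`q = 2`-only Err cell `476882e1 @ 5`**: `BSD(E,5)` over the two packs and `r_an = 0`. [cite: Cremona2006, Table 1 (476882e1)] -/
theorem bsdp_cell_476882e1_at5_of_publishedInputsX6_of_publishedAcInputsX6Pair [Fact (Nat.Prime 5)]
    (hWeq : W = ⟨1, 0, 1, 220814, 286977796⟩) (hPub : PublishedInputsX6) (hAcP : PublishedAcInputsX6Pair)
    (h0 : W.analyticRank = 0) : BSDp W 5 :=
  bsdp_of_exists_inertPairAt certified_records15 (by decide +kernel) hWeq hPub hAcP (by norm_num) h0

/-- **The route's T3 witness cell `22678e1 @ 5`** (Err; pair `(17, 23)` with the unit conjunct): `BSD(E,5)` over the two packs and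
`r_an = 0` — a third road here next to p4's descent closure p546341 and the Err road p558087. [cite: Cremona2006, Table 1 (22678e1)] -/
theorem bsdp_cell_22678e1_at5_of_publishedInputsX6_of_publishedAcInputsX6Pair [Fact (Nat.Prime 5)]
    (hWeq : W = ⟨1, 0, 0, 3140254662, -139987982322460⟩) (hPub : PublishedInputsX6) (hAcP : PublishedAcInputsX6Pair)
    (h0 : W.analyticRank = 0) : BSDp W 5 :=
  bsdp_of_exists_inertPairAt certified_records14 (by decide +kernel) hWeq hPub hAcP (by norm_num) h0

end Cells

end Summit.BirchSwinnertonDyer.Rank1Residual.X6.PrintCert
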